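import Literature.AnabelianGeometry.SemiGraphs.UniformStabilizerSets
import Literature.AnabelianGeometry.SemiGraphs.BranchActionOnFibre

/-!
# Gluing an object of `B(𝒢)` from uniform local data ([SemiAnbd] §2, Prop. 2.5 / 2.6 constructions)

Mochizuki, *Semi-graphs of anabelioids*, Publ. RIMS **42** (2006), §2, proofs of Proposition 2.5
(p. 27: "We construct such a covering by gluing … by choosing appropriate gluing isomorphisms, we obtain
a covering of `𝒢` having the desired properties") and Proposition 2.6 (p. 28: "we construct a [not
necessarily connected!] finite étale covering `𝒢″ → 𝒢′` as follows … Note that the restriction of any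
of these coverings over `w` or `v` to an abutting edge `e` is isomorphic to … Thus, by choosing
appropriate gluing isomorphisms, we obtain a covering") [cite: MochizukiSemiAnbd2006, Prop. 2.6 p.28].

This proof-only file (cell abc-iut, layer L3, row F-1477 / [SemiAnbd] Rmk. 2.10.1, seat
abc-iut-L3-t12) isolates the GLUING STEP as one theorem over abc-iut-L3-t1's `B(𝒢)`
(`SemiGraphOfAnabelioids.BObj`): given, for every vertex `v`, a basepoint `F_v` and an open normal
subgroup `W_v ⊴ Π_v = Aut F_v` of index dividing a common degree `D`, a basepoint `F_e` for every edge,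
transports `α_b : b^* ⋙ F_e ≅ F_v` for the branches, and for every edge an "expected stabiliser"
`K_e ⊆ Π_e = Aut F_e` such that the pull-back of `W_v` along every branch `Π_e → Π_b ⊆ Π_v` is `K_e`
(the MATCHING condition — both ends of an edge see the same `Π_e`-set), there is an object
`A = {S_v, T_e, ψ_b} ∈ B(𝒢)` whose vertex fibres `F_v(S_v)` have `D` points all of stabiliser `W_v`
("`D/[Π_v : W_v]` copies of the covering defined by `Π_v/W_v`") and whose edge fibres `F_e(T_e)` have,
over every edge with an abutting branch, all stabilisers equal to `K_e`
(`exists_bObj_of_uniformLocalData`).  Tools: `UniformStabilizerSets.lean` (objects with uniform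
fibres exist and are determined by degree and stabiliser) and `BranchActionOnFibre.lean` (the
stabiliser of a point of `F_e(b^* S)` is the pull-back of the stabiliser of the transported point).
No statement here takes a side on any disputed claim; nothing about [IUTchIII] Cor. 3.12.
-/

namespace Literature.AnabelianGeometry.SemiGraphs

open CategoryTheory CategoryTheory.Limits CategoryTheory.PreGaloisCategory
open Literature.AnabelianGeometry.Anabelioids

universe v₁ u₁ u

namespace SemiGraphOfAnabelioids

variable (𝒢 : SemiGraphOfAnabelioids.{v₁, u₁, u})

/-- Transport of "all stabilisers equal `K`" along an equality of objects. [folklore] -/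
private theorem stabilizer_eq_of_obj_eq {e : 𝒢.graph.Edge} (Fe : 𝒢.E e ⥤ FintypeCat.{v₁})
    (K : Set (Aut Fe)) {X Y : 𝒢.E e} (hXY : X = Y)
    (hX : ∀ x : Fe.obj X, (MulAction.stabilizer (Aut Fe) x : Set (Aut Fe)) = K) :
    ∀ y : Fe.obj Y, (MulAction.stabilizer (Aut Fe) y : Set (Aut Fe)) = K := by
  subst hXY; exact hX

/-- Transport of the fibre cardinality along an equality of objects. [folklore] -/
private theorem card_eq_of_obj_eq {e : 𝒢.graph.Edge} (Fe : 𝒢.E e ⥤ FintypeCat.{v₁}) {X Y : 𝒢.E e}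
    (hXY : X = Y) : Nat.card (Fe.obj X) = Nat.card (Fe.obj Y) := by
  subst hXY; rfl

/-- Transport of an object of `𝒢_{e}` to `𝒢_{e'}` along `e = e'` keeps "all stabilisers equal to the
expected one" and the fibre cardinality, for edge-indexed basepoints and expected stabilisers.
[folklore] -/
private theorem stabilizer_card_cast (Fe : ∀ e : 𝒢.graph.Edge, 𝒢.E e ⥤ FintypeCat.{v₁})
    (K : ∀ e, Set (Aut (Fe e))) {e e' : 𝒢.graph.Edge} (h : e = e') (X : 𝒢.E e)
    (hX : ∀ x : (Fe e).obj X, (MulAction.stabilizer (Aut (Fe e)) x : Set (Aut (Fe e))) = K e) (D : ℕ)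
    (hc : Nat.card ((Fe e).obj X) = D) :
    (∀ y : (Fe e').obj (h ▸ X), (MulAction.stabilizer (Aut (Fe e')) y : Set (Aut (Fe e'))) = K e') ∧
      Nat.card ((Fe e').obj (h ▸ X)) = D := by
  subst h; exact ⟨hX, hc⟩

/-- **Gluing an object of `B(𝒢)` from uniform local data.**  Let `D ≥ 1`; for every vertex `v` let
`F_v` be a basepoint of `𝒢_v` and `W_v ⊴ Π_v = Aut F_v` an open normal subgroup of index dividing
`D`; for every edge `e` let `F_e` be a basepoint of `𝒢_e` and `K_e ⊆ Π_e = Aut F_e` a subgroup; for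
every branch `b ∈ e` abutting to `v` let `α_b : b^* ⋙ F_e ≅ F_v` be a transport such that the
pull-back of `W_v` along `Π_e → Π_b^{F_e, α_b} ⊆ Π_v` is `K_e` (MATCHING: the same for both ends of
an edge).  Then there is an object `A ∈ B(𝒢)` with `|F_v(S_v)| = D` and all stabilisers of points of
`F_v(S_v)` equal to `W_v`, and with all stabilisers of points of `F_e(T_e)` equal to `K_e` and
`|F_e(T_e)| = D` for every edge `e` with an abutting branch — the covering GLUED from "`D/[Π_v : W_v]`
copies of `Π_v/W_v`" ([SemiAnbd] proofs of Prop. 2.5, p. 27, and Prop. 2.6, p. 28).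
[cite: MochizukiSemiAnbd2006, Prop. 2.6 p.28] -/
theorem exists_bObj_of_uniformLocalData
    (Fv : ∀ v : 𝒢.graph.Vertex, 𝒢.V v ⥤ FintypeCat.{v₁}) [∀ v, FiberFunctor (Fv v)]
    (Fe : ∀ e : 𝒢.graph.Edge, 𝒢.E e ⥤ FintypeCat.{v₁}) [∀ e, FiberFunctor (Fe e)]
    (α : ∀ (b : 𝒢.graph.Branch) (v : 𝒢.graph.Vertex) (h : 𝒢.graph.abuts b = some v),
      (𝒢.pull b v h).pullback ⋙ Fe (𝒢.graph.edgeOf b) ≅ Fv v)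
    (W : ∀ v : 𝒢.graph.Vertex, Subgroup (Aut (Fv v))) [∀ v, (W v).Normal]
    (hWo : ∀ v, IsOpen (W v : Set (Aut (Fv v))))
    (D : ℕ) (hD : 0 < D) (hWD : ∀ v, (W v).index ∣ D)
    (K : ∀ e : 𝒢.graph.Edge, Set (Aut (Fe e)))
    (hK : ∀ (b : 𝒢.graph.Branch) (v : 𝒢.graph.Vertex) (h : 𝒢.graph.abuts b = some v),
      (((W v).comap ((Aut.autMulEquivOfIso (α b v h)).toMonoidHom.comp
        (𝒢.piBToPiV b v h (Fe (𝒢.graph.edgeOf b))))) : Set (Aut (Fe (𝒢.graph.edgeOf b)))) =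
        K (𝒢.graph.edgeOf b)) :
    ∃ A : 𝒢.BObj,
      (∀ v : 𝒢.graph.Vertex, (∀ x : (Fv v).obj (A.S v), MulAction.stabilizer (Aut (Fv v)) x = W v) ∧
        Nat.card ((Fv v).obj (A.S v)) = D) ∧
      ∀ (b : 𝒢.graph.Branch) (v : 𝒢.graph.Vertex), 𝒢.graph.abuts b = some v →
        (∀ y : (Fe (𝒢.graph.edgeOf b)).obj (A.T (𝒢.graph.edgeOf b)),
          (MulAction.stabilizer (Aut (Fe (𝒢.graph.edgeOf b))) y : Set (Aut (Fe (𝒢.graph.edgeOf b)))) =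
            K (𝒢.graph.edgeOf b)) ∧
        Nat.card ((Fe (𝒢.graph.edgeOf b)).obj (A.T (𝒢.graph.edgeOf b))) = D := by
  classical
  -- the vertex objects: `D/[Π_v : W_v]` copies of `Π_v/W_v`
  haveI : ∀ v, (W v).FiniteIndex := fun v => ⟨fun h0 => by
    have := hWD v; rw [h0] at this; exact hD.ne' (Nat.eq_zero_of_zero_dvd this)⟩
  have hSex : ∀ v, ∃ X : 𝒢.V v, Nat.card ((Fv v).obj X) = D ∧
      ∀ x : (Fv v).obj X, MulAction.stabilizer (Aut (Fv v)) x = W v := by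
    intro v
    obtain ⟨X, hc, hs⟩ := exists_obj_uniform_stabilizer (Fv v) (W v) (hWo v) (D / (W v).index)
    exact ⟨X, by rw [hc, Nat.div_mul_cancel (hWD v)], hs⟩
  choose S hScard hSstab using hSex
  -- the pulled-back vertex objects `P_b := b^* S_v` over the edges: uniform with stabiliser `K_e`
  let P : ∀ (b : 𝒢.graph.Branch) (v : 𝒢.graph.Vertex), 𝒢.graph.abuts b = some v →
      𝒢.E (𝒢.graph.edgeOf b) := fun b v h => (𝒢.pull b v h).pullback.obj (S v)
  have hPstab' : ∀ b v h (y : (Fe (𝒢.graph.edgeOf b)).obj (P b v h)),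
      MulAction.stabilizer (Aut (Fe (𝒢.graph.edgeOf b))) y =
        (W v).comap ((Aut.autMulEquivOfIso (α b v h)).toMonoidHom.comp
          (𝒢.piBToPiV b v h (Fe (𝒢.graph.edgeOf b)))) := by
    intro b v h y
    have := stabilizer_pullback_eq_comap (Fv v) b h (Fe (𝒢.graph.edgeOf b)) (α b v h) (S v) y
    rw [this, hSstab v]
  have hPstab : ∀ b v h (y : (Fe (𝒢.graph.edgeOf b)).obj (P b v h)),
      (MulAction.stabilizer (Aut (Fe (𝒢.graph.edgeOf b))) y : Set (Aut (Fe (𝒢.graph.edgeOf b)))) =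
        K (𝒢.graph.edgeOf b) := by
    intro b v h y
    rw [hPstab' b v h y, hK b v h]
  have hPcard : ∀ b v h, Nat.card ((Fe (𝒢.graph.edgeOf b)).obj (P b v h)) = D := by
    intro b v h
    rw [← hScard v]
    exact Nat.card_congr (FintypeCat.equivEquivIso.symm ((α b v h).app (S v)))
  -- the edge objects: over an edge with an abutting branch, (a transport of) some `P_b`; else `⊤`
  let T : ∀ e : 𝒢.graph.Edge, 𝒢.E e := fun e =>
    if hb : ∃ t : Σ' (b : 𝒢.graph.Branch) (v : 𝒢.graph.Vertex), 𝒢.graph.abuts b = some v,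
        𝒢.graph.edgeOf t.1 = e
    then hb.choose_spec ▸ P hb.choose.1 hb.choose.2.1 hb.choose.2.2
    else ⊤_ (𝒢.E e)
  have hT : ∀ (b : 𝒢.graph.Branch) (v : 𝒢.graph.Vertex), 𝒢.graph.abuts b = some v →
      (∀ y : (Fe (𝒢.graph.edgeOf b)).obj (T (𝒢.graph.edgeOf b)),
        MulAction.stabilizer (Aut (Fe (𝒢.graph.edgeOf b))) y = K (𝒢.graph.edgeOf b)) ∧
      Nat.card ((Fe (𝒢.graph.edgeOf b)).obj (T (𝒢.graph.edgeOf b))) = D := by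
    intro b v h
    have hex : ∃ t : Σ' (b' : 𝒢.graph.Branch) (v' : 𝒢.graph.Vertex), 𝒢.graph.abuts b' = some v',
        𝒢.graph.edgeOf t.1 = 𝒢.graph.edgeOf b := ⟨⟨b, v, h⟩, rfl⟩
    have hTb : T (𝒢.graph.edgeOf b) =
        hex.choose_spec ▸ P hex.choose.1 hex.choose.2.1 hex.choose.2.2 := dif_pos hex
    have key := stabilizer_card_cast 𝒢 Fe K hex.choose_spec
      (P hex.choose.1 hex.choose.2.1 hex.choose.2.2) (hPstab _ _ _) D (hPcard _ _ _)
    exact ⟨stabilizer_eq_of_obj_eq 𝒢 (Fe _) (K _) hTb.symm key.1,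
      (card_eq_of_obj_eq 𝒢 (Fe _) hTb).trans key.2⟩
  -- the gluing isomorphisms `ψ_b : b^* S_v ≅ T_e`: uniform fibres with the same stabiliser and degree
  have hψ : ∀ (b : 𝒢.graph.Branch) (v : 𝒢.graph.Vertex) (h : 𝒢.graph.abuts b = some v),
      Nonempty (P b v h ≅ T (𝒢.graph.edgeOf b)) := fun b v h =>
    nonempty_iso_of_stabilizer_eq (Fe (𝒢.graph.edgeOf b)) _ (hPstab' b v h)
      (fun y => SetLike.coe_injective (((hT b v h).1 y).trans (hK b v h).symm))
      ((hPcard b v h).trans (hT b v h).2.symm)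
  refine ⟨{ S := S, T := T, ψ := fun b v h => (hψ b v h).some }, fun v => ⟨hSstab v, hScard v⟩,
    fun b v h => hT b v h⟩

end SemiGraphOfAnabelioids

end Literature.AnabelianGeometry.SemiGraphs
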